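import Summits.CriticalPhenomena.PercolationContinuityZ3.Theorems.SahiMasterFamilySparseEndTheorem

/-!
# The sparse end of Sahi's hierarchy, VIII: continuity of `Ẽ`, the limit `E_k / p^m → Ẽ(0)`, and EVENTUAL POSITIVITY

Support file of the master-family programme (crux `NoHeavyLowerTail`, stmt-CriticalPhenomena-4575; cell `prim-masterthm`, seat P4,
unit `prim-masterthm-p4-g5`).  Seat document CORNERS.md §1.

`SahiMasterFamilySparseEndExpansion.sahiE_spw_eq` factors Sahi's functional of a family of increasing events under the product measure
with intensities `p·w_e` as `E_{n+1}(spw w p; 1_U) = p^m · Ẽ(p)` and `SahiMasterFamilySparseEndTheorem.sparseE_zero_nonneg` gives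
`Ẽ(0) ≥ 0`.  This file makes the asymptotic content explicit (the packaged corollary `sahiE_spw_sparse_end` of file VII did not record
that `Ẽ` is continuous, so that `m` there was not yet pinned down as the order of vanishing):

* `continuous_sparseE` — `Ẽ` is continuous in `p` (a finite sum of products of polynomials);
* `tendsto_sahiE_div_pow` — `E_{n+1}(spw w p; 1_U) / p^m → Ẽ(0)` as `p → 0`, `p ≠ 0`;
* **`exists_pos_forall_sahiE_spw_pos`** — EVENTUAL POSITIVITY: if `Ẽ(0) > 0` then `E_{n+1}(spw w p; 1_U) > 0` for all
  `p ∈ (0, δ)`; in particular (`sahiE_spw_pos_of_lambdaSys_pos`) whenever the intensities are positive and SOME minimum common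
  configuration `c` has `Λ'(F^{(c)}) > 0`;
* `sahiE_spw_sparse_end_continuous` — the packaged form with continuity and the value `Ẽ(0) = Σ_c w^c Λ'(F^{(c)})`.
HONEST FRAMING: statements about a neighbourhood of `p = 0` only; Sahi `C_k` for product measures / Kahn Conj. 5 remain open.
[this work]
-/

namespace Summit.CriticalPhenomena.PercolationContinuityZ3.Theorems

namespace SahiSparseEnd

open Finset Filter Topology SahiRepresentativeForm SahiLightAtoms
open Literature.Combinatorics.Sahi2008

variable {ι : Type*} [Fintype ι] [DecidableEq ι]

/-! ### Continuity in `p` -/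

/-- `p ↦ spw w p ω` is continuous. [this work] -/
@[fun_prop]
theorem continuous_spw (w : ι → ℝ) (ω : Finset ι) : Continuous fun p : ℝ => spw w p ω := by
  unfold spw; fun_prop

/-- `p ↦ redFactor w p a j` is continuous. [this work] -/
@[fun_prop]
theorem continuous_redFactor (w : ι → ℝ) (a : Finset ι) (j : ℕ) : Continuous fun p : ℝ => redFactor w p a j := by
  unfold redFactor; fun_prop

/-- `p ↦ redTerm w p γ` is continuous. [this work] -/
@[fun_prop]
theorem continuous_redTerm (w : ι → ℝ) {n : ℕ} (γ : Fin n → Finset ι) : Continuous fun p : ℝ => redTerm w p γ := by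
  unfold redTerm; fun_prop

/-- **`Ẽ` is continuous in `p`.** [this work] -/
@[fun_prop]
theorem continuous_sparseE (w : ι → ℝ) {n : ℕ} (U : Fin (n + 1) → Finset (Finset ι)) (m : ℕ) :
    Continuous fun p : ℝ => sparseE w U m p := by
  unfold sparseE; fun_prop

section Events

variable {n : ℕ} (U : Fin (n + 1) → Finset (Finset ι))
  (hU : ∀ i a a', a ∈ U i → a ⊆ a' → a' ∈ U i) (h0 : ∀ i, ∅ ∉ U i)

include hU in
/-- **The limit form of the sparse end**: `E_{n+1}(spw w p; 1_U) / p^m → Ẽ(0)` as `p → 0` (`p ≠ 0`). [this work] -/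
theorem tendsto_sahiE_div_pow (w : ι → ℝ) (h : (common U).Nonempty) :
    Tendsto (fun p : ℝ => sahiE (spw w p) (n + 1) (fun i => setInd (U i)) / p ^ minSize U h)
      (𝓝[≠] 0) (𝓝 (sparseE w U (minSize U h) 0)) := by
  have hc : Tendsto (fun p : ℝ => sparseE w U (minSize U h) p) (𝓝[≠] 0) (𝓝 (sparseE w U (minSize U h) 0)) :=
    ((continuous_sparseE w U (minSize U h)).tendsto 0).mono_left nhdsWithin_le_nhds
  refine hc.congr' ?_
  filter_upwards [self_mem_nhdsWithin] with p hp
  rw [sahiE_spw_eq U hU w p h, mul_div_cancel_left₀ _ (pow_ne_zero _ hp)]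

include hU in
/-- **EVENTUAL POSITIVITY.**  If the leading coefficient `Ẽ(0)` is positive then `E_{n+1}(spw w p; 1_U) > 0` for all sufficiently
small `p > 0`. [this work] -/
theorem exists_pos_forall_sahiE_spw_pos (w : ι → ℝ) (h : (common U).Nonempty) (hpos : 0 < sparseE w U (minSize U h) 0) :
    ∃ δ > 0, ∀ p : ℝ, 0 < p → p < δ → 0 < sahiE (spw w p) (n + 1) (fun i => setInd (U i)) := by
  have hc : ContinuousAt (fun p : ℝ => sparseE w U (minSize U h) p) 0 := (continuous_sparseE w U (minSize U h)).continuousAt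
  have hev : ∀ᶠ p in 𝓝 (0 : ℝ), 0 < sparseE w U (minSize U h) p := hc.eventually (lt_mem_nhds hpos)
  obtain ⟨δ, hδ, hball⟩ := Metric.eventually_nhds_iff.1 hev
  refine ⟨δ, hδ, fun p hp hpδ => ?_⟩
  have hp' : 0 < sparseE w U (minSize U h) p := hball (by rw [Real.dist_eq, sub_zero, abs_of_pos hp]; exact hpδ)
  rw [sahiE_spw_eq U hU w p h]
  exact mul_pos (pow_pos hp _) hp'

include hU h0 in
/-- **Eventual positivity from one good corner configuration.**  If the intensities are positive and SOME minimum-size common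
configuration `c` of the events has positive leading coefficient `Λ'(F^{(c)}) > 0`, then `E_{n+1}(spw w p; 1_U) > 0` for all
sufficiently small `p > 0`. [this work] -/
theorem sahiE_spw_pos_of_lambdaSys_pos {w : ι → ℝ} (hw : ∀ e, 0 < w e) (h : (common U).Nonempty) {c : Finset ι}
    (hc : c ∈ commonMin U h) (hΛ : 0 < LambdaSys (Fc U c) c) :
    ∃ δ > 0, ∀ p : ℝ, 0 < p → p < δ → 0 < sahiE (spw w p) (n + 1) (fun i => setInd (U i)) := by
  refine exists_pos_forall_sahiE_spw_pos U hU w h ?_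
  rw [sparseE_zero_eq U hU h0 w h]
  have hterm : ∀ c' ∈ commonMin U h, 0 ≤ (∏ e ∈ c', w e) * (LambdaSys (Fc U c') c' : ℝ) := by
    intro c' hc'
    have hc'' := mem_filter.1 hc'
    refine mul_nonneg (prod_nonneg fun e _ => (hw e).le) (Int.cast_nonneg ?_)
    refine LambdaSys_nonneg (F := Fc U c') (c := c') ?_ ?_ ?_ (Nat.succ_pos n)
    · intro i a a' ha haa' ha'c
      rw [Fc, mem_filter] at ha ⊢
      exact ⟨hU i a a' ha.1 haa', ha'c⟩
    · intro a hac
      constructor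
      · intro hall
        have haU : a ∈ common U := (mem_common U).2 fun i => (mem_filter.1 (hall i)).1
        exact eq_of_subset_of_card_le hac (hc''.2 ▸ minSize_le U haU)
      · rintro rfl
        exact fun i => mem_filter.2 ⟨(mem_common U).1 hc''.1 i, subset_rfl⟩
    · intro i hi
      exact h0 i (mem_filter.1 hi).1
  calc (0 : ℝ) < (∏ e ∈ c, w e) * (LambdaSys (Fc U c) c : ℝ) :=
        mul_pos (prod_pos fun e _ => hw e) (Int.cast_pos.2 hΛ)
    _ ≤ ∑ c' ∈ commonMin U h, (∏ e ∈ c', w e) * (LambdaSys (Fc U c') c' : ℝ) :=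
        single_le_sum hterm hc

include hU h0 in
/-- **The sparse end, packaged with continuity**: `E_{n+1}(spw w p; 1_U) = p^m · Ẽ(p)` for all real `p`, with `Ẽ` CONTINUOUS,
`Ẽ(0) = Σ_{c min} w^c Λ'(F^{(c)}) ≥ 0` and `m` the minimum size of a common configuration — so `m` is the exact order of
vanishing at `p = 0` whenever `Ẽ(0) ≠ 0`. [this work] -/
theorem sahiE_spw_sparse_end_continuous {w : ι → ℝ} (hw : ∀ e, 0 ≤ w e) (huniv : ∀ i, (univ : Finset ι) ∈ U i) :
    ∃ Et : ℝ → ℝ, Continuous Et ∧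
      (∀ p, sahiE (spw w p) (n + 1) (fun i => setInd (U i)) = p ^ minSize U (common_nonempty U huniv) * Et p) ∧
      Et 0 = ∑ c ∈ commonMin U (common_nonempty U huniv), (∏ e ∈ c, w e) * (LambdaSys (Fc U c) c : ℝ) ∧ 0 ≤ Et 0 :=
  ⟨sparseE w U (minSize U (common_nonempty U huniv)), continuous_sparseE w U _, fun p => sahiE_spw_eq U hU w p _,
    sparseE_zero_eq U hU h0 w _, sparseE_zero_nonneg U hU h0 hw _⟩

end Events

end SahiSparseEnd

end Summit.CriticalPhenomena.PercolationContinuityZ3.Theorems
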